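import Literature.NumberTheory.Automorphic.JacquetModule      -- ★ `ParabolicTriple.IwahoriDatum` (`K`, `isOpen_K`, `isCompact_K`, `hasBasis_K`)
import HarnessLib

/-!
# F0 · P3c · line LH6 «StCharTS» — road (D) «DEEP-FL», brick «T-BASIS»: the level groups `T ∩ K_n` of an Iwahori datum on a torus, and compact
# `K`-stable sets as finite disjoint unions of `K`-cosets

Cell `pub/hodgecm-mathlib`, crux H413 = `stmt-HodgeConjecture-24833` (lane `--supports … --as helper`), route HCCMUnconditional; seat LH6-p03 (g0); desk F0P3b-plan (g23)
RULING 05:51:45Z «(c₅)(iii) LEVEL COMPATIBILITY dropped → COSET REFINEMENT» + DEAL «T-BASIS★»; road (D) owner LH6-p04 (g2).  THEOREMS ONLY, sorry-free, ★-only imports; no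
definition ∕ instance ∕ notation ∕ named fact.  HONEST LABEL: HC_CM is proved only modulo the 7 printed citations (2 remaining: hLiu418 = stmt-HodgeConjecture-24832, h413 =
stmt-HodgeConjecture-24833) until rung 0 closes; count-neutral plumbing of road (D): the H-test function of record becomes a finite sum `Σ_j c_j · 𝟙_{K_{H,n′} u_j K_{H,n′}}`
over a finite disjoint coset decomposition `W·b·(T ∩ K_n) = ⨆_j u_j (T ∩ K_{H,n′})`, which is what this file supplies in GENERIC form (pure topological-group algebra over ★
`ParabolicTriple.IwahoriDatum`, so it serves `T ≤ U(Φ₃)`, `T_H ≤ U(Φ₂) × U(Φ₁)` and any transport alike).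

CONTENTS.  §1 (TB2 core) for an OPEN subgroup `K` of a topological group and a COMPACT set `S` with `S·K ⊆ S`: `S` is a finite union of cosets `u • K`, `u ∈ S`
(`exists_finset_subset_eq_biUnion_smul`, compactness), and a finite DISJOINT union of `K`-cosets (`exists_finset_pairwiseDisjoint_eq_biUnion_smul`, canonical representatives
`Quotient.out`; two `K`-cosets are equal or disjoint, `smul_coe_eq_or_disjoint`).  §2 (TB1) for an Iwahori datum `𝓘` of a parabolic triple and ANY subgroup `T`: the traces
`T ∩ 𝓘.K n` are open in `T` (`isOpen_preimage_K`), compact when `T` is closed (`isCompact_inter_K`), and form a neighbourhood basis of `1` in `T` for the subspace topology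
(`exists_preimage_K_subset_of_mem_nhds`, from `hasBasis_K`).  §3 (TB2 on the torus) every compact `S ⊆ T` stable under `T ∩ 𝓘.K n′` is a finite disjoint union of
`(T ∩ 𝓘.K n′)`-cosets (`exists_finset_pairwiseDisjoint_eq_biUnion_smul_subgroupOf_K`).  (No monotonicity of `n ↦ 𝓘.K n` is assumed — the structure has none — so «for all
large `n′`» is delivered as «there is an `n′`» plus stability under any smaller open subgroup.)

## References
* [Casselman1995] W. Casselman, *Introduction to the theory of admissible representations of p-adic reductive groups* (1995 notes): §1.4 Prop. 1.4.4 p. 14 (Iwahori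
  factorisation and the level groups `K_n`), §1.5 p. 16.
* [Rogawski1990] J. D. Rogawski, *Automorphic Representations of Unitary Groups in Three Variables*, Ann. of Math. Stud. 123 (1990): §4.9 p. 55; §12.7 L. 12.7.3 p. 195.
* [BernsteinZelevinsky1977] I. N. Bernstein, A. V. Zelevinsky, *Induced representations of reductive p-adic groups I*, Ann. Sci. ÉNS 10 (1977): §1.8.
-/

set_option autoImplicit false
-- the mandated namespace has the single-problem summit's repeated segment (`HodgeConjecture.HodgeConjecture`)
set_option linter.dupNamespace false

open Set Topology
open scoped Pointwise
open Literature.NumberTheory.Automorphic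

namespace Summit.HodgeConjecture.HodgeConjecture.Cruxes.H413.F0P3cStCharTSTorusLevelBasis

variable {G : Type*} [Group G] [TopologicalSpace G] [IsTopologicalGroup G]

/-! ## §1 Compact `K`-stable sets are finite disjoint unions of `K`-cosets -/

omit [TopologicalSpace G] [IsTopologicalGroup G] in
/-- Two left cosets of a subgroup are equal or disjoint. [cite: BernsteinZelevinsky1977, §1.8] -/
theorem smul_coe_eq_or_disjoint (K : Subgroup G) (a b : G) :
    a • (K : Set G) = b • (K : Set G) ∨ Disjoint (a • (K : Set G)) (b • (K : Set G)) := by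
  by_cases h : a⁻¹ * b ∈ K
  · exact Or.inl ((leftCoset_eq_iff K).2 h)
  · refine Or.inr (Set.disjoint_left.2 fun z hza hzb => h ?_)
    rw [mem_leftCoset_iff] at hza hzb
    have : a⁻¹ * b = a⁻¹ * z * (b⁻¹ * z)⁻¹ := by group
    rw [this]
    exact K.mul_mem hza (K.inv_mem hzb)

omit [IsTopologicalGroup G] in
/-- A left coset of an open subgroup is open. [cite: Casselman1995, §1.4 p. 14] -/
theorem isOpen_smul_coe [ContinuousMul G] {K : Subgroup G} (hK : IsOpen (K : Set G)) (u : G) : IsOpen (u • (K : Set G)) := by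
  rw [← Set.image_smul]
  exact isOpenMap_mul_left u _ hK

/-- **(TB2, core)**: a COMPACT set `S` stable under right multiplication by an OPEN subgroup `K` (`S·K ⊆ S`) is a finite union of cosets `u • K` with `u ∈ S`.
[cite: Casselman1995, §1.4 Prop. 1.4.4 p. 14] -/
theorem exists_finset_subset_eq_biUnion_smul (K : Subgroup G) (hK : IsOpen (K : Set G)) {S : Set G} (hS : IsCompact S)
    (hSK : ∀ s ∈ S, ∀ k ∈ K, s * k ∈ S) :
    ∃ F : Finset G, (↑F : Set G) ⊆ S ∧ S = ⋃ u ∈ F, u • (K : Set G) := by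
  have hcov : S ⊆ ⋃ u ∈ S, u • (K : Set G) :=
    fun s hs => Set.mem_biUnion hs (Set.mem_smul_set.2 ⟨1, K.one_mem, by rw [smul_eq_mul, mul_one]⟩)
  obtain ⟨F₀, hF₀S, hF₀, hSF₀⟩ := hS.elim_finite_subcover_image (fun u _ => isOpen_smul_coe hK u) hcov
  refine ⟨hF₀.toFinset, by rwa [Set.Finite.coe_toFinset], Set.Subset.antisymm ?_ ?_⟩
  · simpa only [Set.Finite.mem_toFinset] using hSF₀
  · refine Set.iUnion₂_subset fun u hu => ?_
    rw [Set.Finite.mem_toFinset] at hu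
    rintro _ ⟨k, hk, rfl⟩
    exact hSK u (hF₀S hu) k hk

/-- **(TB2, disjoint form)**: a COMPACT set `S` with `S·K ⊆ S` for an OPEN subgroup `K` is a finite DISJOINT union of `K`-cosets contained in `S`.
[cite: Casselman1995, §1.4 Prop. 1.4.4 p. 14] -/
theorem exists_finset_pairwiseDisjoint_eq_biUnion_smul (K : Subgroup G) (hK : IsOpen (K : Set G)) {S : Set G} (hS : IsCompact S)
    (hSK : ∀ s ∈ S, ∀ k ∈ K, s * k ∈ S) :
    ∃ F : Finset G, (∀ u ∈ F, u • (K : Set G) ⊆ S) ∧ (↑F : Set G).PairwiseDisjoint (fun u => u • (K : Set G)) ∧ S = ⋃ u ∈ F, u • (K : Set G) := by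
  classical
  obtain ⟨F₀, hF₀S, hSF₀⟩ := exists_finset_subset_eq_biUnion_smul K hK hS hSK
  -- canonical representatives
  let r : G → G := fun u => ((u : G ⧸ K)).out
  have hr : ∀ u, r u • (K : Set G) = u • (K : Set G) := fun u => by
    obtain ⟨h, hh⟩ := QuotientGroup.mk_out_eq_mul K u
    change ((u : G ⧸ K)).out • (K : Set G) = _
    rw [hh, ← smul_smul, leftCoset_mem_leftCoset K h.2]
  have hsub : ∀ u ∈ F₀, u • (K : Set G) ⊆ S := fun u hu => by
    rintro _ ⟨k, hk, rfl⟩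
    exact hSK u (hF₀S hu) k hk
  refine ⟨F₀.image r, fun u hu => ?_, fun a ha b hb hab => ?_, ?_⟩
  · obtain ⟨u₀, hu₀, rfl⟩ := Finset.mem_image.1 hu
    rw [hr]
    exact hsub u₀ hu₀
  · obtain ⟨a₀, -, rfl⟩ := Finset.mem_image.1 (Finset.mem_coe.1 ha)
    obtain ⟨b₀, -, rfl⟩ := Finset.mem_image.1 (Finset.mem_coe.1 hb)
    rcases smul_coe_eq_or_disjoint K (r a₀) (r b₀) with h | h
    · refine absurd ?_ hab
      have hq : ((r a₀ : G) : G ⧸ K) = ((r b₀ : G) : G ⧸ K) := QuotientGroup.eq.2 ((leftCoset_eq_iff K).1 h)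
      change ((a₀ : G ⧸ K)).out = ((b₀ : G ⧸ K)).out
      have ha₀ : (((a₀ : G ⧸ K)).out : G ⧸ K) = (a₀ : G ⧸ K) := QuotientGroup.out_eq' _
      have hb₀ : (((b₀ : G ⧸ K)).out : G ⧸ K) = (b₀ : G ⧸ K) := QuotientGroup.out_eq' _
      have : (a₀ : G ⧸ K) = (b₀ : G ⧸ K) := by rw [← ha₀, ← hb₀]; exact hq
      rw [this]
    · exact h
  · rw [hSF₀]
    refine Set.Subset.antisymm (Set.iUnion₂_subset fun u hu => ?_) (Set.iUnion₂_subset fun u hu => ?_)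
    · exact Set.subset_biUnion_of_mem (u := fun u => u • (K : Set G)) (Finset.mem_coe.2 (Finset.mem_image_of_mem r hu)) |>.trans' (by rw [hr])
    · obtain ⟨u₀, hu₀, rfl⟩ := Finset.mem_image.1 hu
      rw [hr]
      exact Set.subset_biUnion_of_mem (u := fun u => u • (K : Set G)) (Finset.mem_coe.2 hu₀)

/-! ## §2 (TB1) The level groups of an Iwahori datum on a subgroup `T` -/

omit [IsTopologicalGroup G] in
/-- `T ∩ 𝓘.K n` is open in `T` (subspace topology). [cite: Casselman1995, §1.4 Prop. 1.4.4 p. 14] -/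
theorem isOpen_preimage_K (t : ParabolicTriple G) (𝓘 : t.IwahoriDatum) (T : Subgroup G) (n : ℕ) :
    IsOpen ((Subtype.val : ↥T → G) ⁻¹' (𝓘.K n : Set G)) :=
  (𝓘.isOpen_K n).preimage continuous_subtype_val

omit [IsTopologicalGroup G] in
/-- `T ∩ 𝓘.K n` (as the subgroup `(𝓘.K n).subgroupOf T` of `T`) is open in `T`. [cite: Casselman1995, §1.4 Prop. 1.4.4 p. 14] -/
theorem isOpen_coe_subgroupOf_K (t : ParabolicTriple G) (𝓘 : t.IwahoriDatum) (T : Subgroup G) (n : ℕ) :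
    IsOpen (((𝓘.K n).subgroupOf T : Subgroup ↥T) : Set ↥T) := by
  rw [Subgroup.coe_subgroupOf]
  exact isOpen_preimage_K t 𝓘 T n

omit [IsTopologicalGroup G] in
/-- `T ∩ 𝓘.K n` is compact when `T` is closed. [cite: Casselman1995, §1.4 Prop. 1.4.4 p. 14] -/
theorem isCompact_inter_K (t : ParabolicTriple G) (𝓘 : t.IwahoriDatum) (T : Subgroup G) (hT : IsClosed (T : Set G)) (n : ℕ) :
    IsCompact ((T : Set G) ∩ (𝓘.K n : Set G)) :=
  (𝓘.isCompact_K n).inter_left hT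

omit [IsTopologicalGroup G] in
/-- **(TB1)**: the level groups `T ∩ 𝓘.K n` form a neighbourhood basis of `1` in `T` (subspace topology): every neighbourhood of `1` in `T` contains some `T ∩ 𝓘.K n`.
[cite: Casselman1995, §1.4 Prop. 1.4.4 p. 14] -/
theorem exists_preimage_K_subset_of_mem_nhds (t : ParabolicTriple G) (𝓘 : t.IwahoriDatum) (T : Subgroup G) {U : Set ↥T} (hU : U ∈ 𝓝 (1 : ↥T)) :
    ∃ n : ℕ, (Subtype.val : ↥T → G) ⁻¹' (𝓘.K n : Set G) ⊆ U := by
  rw [nhds_induced] at hU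
  obtain ⟨V, hV, hVU⟩ := hU
  rw [OneMemClass.coe_one] at hV
  obtain ⟨n, hn⟩ := 𝓘.hasBasis_K V hV
  exact ⟨n, (Set.preimage_mono hn).trans hVU⟩

omit [IsTopologicalGroup G] in
/-- **(TB1, with an open target)**: every open `U ∋ 1` of `G` contains `T ∩ 𝓘.K n` for some `n` (in particular a level `T ∩ 𝓘.K n′` of one datum sits inside any level
`T ∩ 𝓘′.K n` of another). [cite: Casselman1995, §1.4 Prop. 1.4.4 p. 14] -/
theorem exists_inter_K_subset_of_isOpen (t : ParabolicTriple G) (𝓘 : t.IwahoriDatum) (T : Subgroup G) {U : Set G} (hU : IsOpen U) (h1 : (1 : G) ∈ U) :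
    ∃ n : ℕ, (T : Set G) ∩ (𝓘.K n : Set G) ⊆ U := by
  obtain ⟨n, hn⟩ := 𝓘.hasBasis_K U (hU.mem_nhds h1)
  exact ⟨n, Set.inter_subset_right.trans hn⟩

/-! ## §3 (TB2 on the torus) compact level-stable subsets of `T` -/

/-- **(TB2)**: for an Iwahori datum `𝓘`, a subgroup `T` and a level `n′`, every COMPACT `S ⊆ T` stable under right multiplication by `T ∩ 𝓘.K n′` is a finite DISJOINT
union of `(T ∩ 𝓘.K n′)`-cosets `u_j · (T ∩ 𝓘.K n′) ⊆ S` — the coset refinement under which the `H`-test function of road (D) becomes `Σ_j c_j 𝟙_{K_{n′} u_j K_{n′}}`.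
[cite: Casselman1995, §1.4 Prop. 1.4.4 p. 14] [cite: Rogawski1990, §12.7 L. 12.7.3 p. 195] -/
theorem exists_finset_pairwiseDisjoint_eq_biUnion_smul_subgroupOf_K (t : ParabolicTriple G) (𝓘 : t.IwahoriDatum) (T : Subgroup G) (n' : ℕ)
    {S : Set ↥T} (hS : IsCompact S) (hSK : ∀ s ∈ S, ∀ k ∈ (𝓘.K n').subgroupOf T, s * k ∈ S) :
    ∃ F : Finset ↥T, (∀ u ∈ F, u • (((𝓘.K n').subgroupOf T : Subgroup ↥T) : Set ↥T) ⊆ S) ∧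
      (↑F : Set ↥T).PairwiseDisjoint (fun u => u • (((𝓘.K n').subgroupOf T : Subgroup ↥T) : Set ↥T)) ∧
      S = ⋃ u ∈ F, u • (((𝓘.K n').subgroupOf T : Subgroup ↥T) : Set ↥T) :=
  exists_finset_pairwiseDisjoint_eq_biUnion_smul ((𝓘.K n').subgroupOf T) (isOpen_coe_subgroupOf_K t 𝓘 T n') hS hSK

end Summit.HodgeConjecture.HodgeConjecture.Cruxes.H413.F0P3cStCharTSTorusLevelBasis
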